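import Summits.QuantumFields.BalabanUV.T4Continuum.Support.NE7EtaBackgroundFlatStratum
import Summits.QuantumFields.BalabanUV.T4Continuum.Support.NE3SmoothLiftW
import Summits.QuantumFields.BalabanUV.T4Continuum.Support.AveragingDeficitKDatum
import HarnessLib

/-!
# NE7FlatDatumNormalForm — THE PERIODIC-GAUGE NORMAL FORM OF A FLAT DATUM: «flat = constant up to a PERIODIC gauge», given commuting skew-Hermitian
# logarithms of the axis holonomies — the fibre over any flat datum is carried by a periodic unitary gauge onto the fibre over a CONSTANT commuting datum

Cell `pub-balaban`, rung (B)+1 sub-cell t4, lineage `b2b-balaban-t4-ne7-p2`, generation 89 (CRUX PROVER NE7 #2 = co-owner of row NE7, kernel hand); file (G2)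
of the gen-89 line «the (APE) END along the FLAT STRATUM», over the tree's quasi-periodic description of flat data (`NE7EtaBackgroundFlatStratum`, t4-ne7-p1),
the zero-curvature ⇒ pure-gauge lemma (`NE3EnergyRateFlatClass`) and the gauge covariance of the iterated average (`NE3CpushGaugeCovariance.cavgIter_gaugeAct`).
WHY.  After D9 ∕ D11 (finite order modulo the centre) and the reduction T′ (`NE7ApeFlatEndOfRobustEnd`), the infinite-order flat data need a ROBUST END.  The
natural fear is that this needs the twisted torus (`U(x+Pe_j) = Ad_{h_j}U(x)`).  It does not: if `D = cavgIter L (k+1) U` is flat and `P₀`-periodic with axis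
holonomies `τ_i = D([0,P₀e_i])`, and `Y_i` are COMMUTING skew-Hermitian logarithms (`e^{Y_i} = τ_i`; they exist — simultaneous diagonalisation — but are an
INPUT here), then with the normalised quasi-periodic gauge `w` (`D = 1^{w}`, `w(0) = 1`, `w(y + P₀e_i) = w(y)·τ_i⁻¹`), the LINEAR UNWINDING
`E(y) = exp(Σ_j (y_j∕P₀)Y_j)` and `V = w·E`, the gauge `V` IS `P₀`-PERIODIC (the factors `τ_i⁻¹·e^{Y_i}` cancel) and `(1^{w})^{V⁻¹}(y,i) = e^{Y_i∕P₀}` — a CONSTANT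
commuting configuration; blowing `V⁻¹` up to the fine lattice (`G(z) = V(⌊z∕M⌋)⁻¹`, `M = L^{k+1}`, periodic of period `M·P₀`) and using the covariance of the
average, `cavgIter L (k+1) (U^{G}) = const (e^{Y_i∕P₀})_i`.  So the robust END of T′ may be proved at a CONSTANT commuting background, in the periodic setting.
WHAT ([folklore]; 0 def, 0 sorry; the gauges are written out, no `def`).  §1 THE BLOW-UP GAUGE `z ↦ w(⌊z∕L^{k+1}⌋)⁻¹`: `blowInv_corner`, `blowInv_unitary`,
`blowInv_add_period`.  §2 THE UNWINDING EXPONENT `S(y) = Σ_j (y_j∕P₀)•Y_j`: `unwind_add_e` (`S(y+e_μ) = S(y) + P₀⁻¹•Y_μ`), `unwind_add_period` (`S(y+P₀e_i) = S(y) + Y_i`),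
`commute_unwind`, `unwind_mem_skewAdjoint`, `exp_unwind_mem_unitary`.  §3 **`exists_periodic_gauge_cavgIter_eq_const`**: for `U` unitary of the multi-level class,
`(L^{k+1}P₀)`-periodic, with flat `(k+1)`-fold average and commuting skew-Hermitian logs `Y_i` of its period-`P₀` axis holonomies: `∃ G` unitary, `(L^{k+1}P₀)`-periodic,
with `cavgIter L (k+1) (U^{G}) = (y,i) ↦ expUnit (P₀⁻¹ • Y_i)`.
HONEST FRAMING (page 1): lattice gauge bookkeeping ([folklore]); the logarithms are hypotheses; nothing of Bałaban's asserted; moves no letter by itself; the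
robust END is NOT here; (APE) on the data class NOT proved; NE7 NOT PRINTED ∕ NOT PROVED; spine PROVED 0∕9; FIXED FINITE T⁴, rung (B)+1 — NOT infinite volume,
NOT mass gap, NOT BetaPertH, NOT Clay.  Continuum YM on T⁴ ⇐ BetaPertH ∧ nine spine estimates (0/9 proved); BetaPertH ⇐ (D1) ∧ (D4) ∧ CAP+tail; G-an2-4 gates
asym, D1 and NE2/3/4.
-/

set_option autoImplicit false

open scoped BigOperators Matrix.Norms.L2Operator
open NormedSpace Finset

namespace Summit.QuantumFields.BalabanUV.T4Continuum.NE7FlatDatumNormalForm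

open Literature.MathematicalPhysics.QuantumFieldTheory.Balaban1983to89
open B7Prop1Explicit B7Prop2Explicit
open T4AveragingDeficitWall (IsUnitaryCfg SmallField hol_flat)
open T4AveragingDeficitWallBoundary (IsPeriodicCfg)
open AveragingDeficitMultiLevelPrep (cavgIter LevelSmall cavgIter_unitary_small isPeriodicCfg_cavgIter)
open MinimalActionWitness (flatCfg)
open NE3EnergyShapes (IsUnitarySite IsPeriodicSite)
open NE3EnergyRateFlatClass (exists_unitary_gauge_eq_gaugeAct_flatCfg)
open NE7EtaBackgroundFlatStratum (apply_add_period_eq_of_isPeriodicCfg gaugeAct_mul_const_flatCfg)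
open NE3CpushGaugeCovariance (cavgIter_gaugeAct)
open NE3SmoothLiftW (tower_eq_pow_mul)
open AveragingDeficitKDatum (isUnitaryCfg_gaugeAct gaugeAct_inv_gaugeAct)

noncomputable section

variable {d : ℕ} {n : Type*} [Fintype n] [DecidableEq n]

/-! ## §1 The blow-up gauge `z ↦ w(⌊z∕L^{k+1}⌋)⁻¹` -/

/-- At a block corner `L^{k+1}•y` the blow-up gauge reads `w(y)⁻¹`. [folklore] -/
theorem blowInv_corner {L : ℕ} (hL : 1 ≤ L) (k : ℕ) (w : Site d → (Matrix n n ℂ)ˣ) (y : Site d) :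
    (fun z : Site d => (w (fun i => z i / (L : ℤ) ^ (k + 1)))⁻¹) (((L : ℤ) ^ (k + 1)) • y) = (w y)⁻¹ := by
  have hM : ((L : ℤ) ^ (k + 1)) ≠ 0 := pow_ne_zero _ (by exact_mod_cast (by omega : L ≠ 0))
  have hy : (fun i => (((L : ℤ) ^ (k + 1)) • y) i / (L : ℤ) ^ (k + 1)) = y := by
    funext i
    simp only [Pi.smul_apply, smul_eq_mul]
    exact Int.mul_ediv_cancel_left _ hM
  simp only [hy]

/-- The blow-up gauge of a unitary `w` is unitary. [folklore] -/
theorem blowInv_unitary {L : ℕ} (k : ℕ) {w : Site d → (Matrix n n ℂ)ˣ} (hw : IsUnitarySite w) :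
    IsUnitarySite (fun z : Site d => (w (fun i => z i / (L : ℤ) ^ (k + 1)))⁻¹) :=
  fun _ => (unitaryUnits (Matrix n n ℂ)).inv_mem (hw _)

/-- The blow-up gauge of a `Q`-periodic `w` is `L^{k+1}·Q`-periodic. [folklore] -/
theorem blowInv_add_period {L : ℕ} (hL : 1 ≤ L) (k : ℕ) {Q : ℕ} {w : Site d → (Matrix n n ℂ)ˣ}
    (hwQ : ∀ (y : Site d) (i : Fin d), w (y + (Q : ℤ) • e i) = w y) :
    ∀ (z : Site d) (i : Fin d),
      (fun z' : Site d => (w (fun j => z' j / (L : ℤ) ^ (k + 1)))⁻¹) (z + (((L ^ (k + 1) * Q : ℕ) : ℤ)) • e i)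
        = (fun z' : Site d => (w (fun j => z' j / (L : ℤ) ^ (k + 1)))⁻¹) z := by
  intro z i
  have hM : ((L : ℤ) ^ (k + 1)) ≠ 0 := pow_ne_zero _ (by exact_mod_cast (by omega : L ≠ 0))
  have hz : (fun j => (z + (((L ^ (k + 1) * Q : ℕ) : ℤ)) • e i) j / (L : ℤ) ^ (k + 1))
      = (fun j => z j / (L : ℤ) ^ (k + 1)) + (Q : ℤ) • e i := by
    funext j
    simp only [Pi.add_apply, Pi.smul_apply, smul_eq_mul]
    have hc : (((L ^ (k + 1) * Q : ℕ) : ℤ)) * e i j = ((Q : ℤ) * e i j) * (L : ℤ) ^ (k + 1) := by push_cast; ring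
    rw [hc, Int.add_mul_ediv_right _ _ hM]
  simp only [hz, hwQ]

/-! ## §2 The unwinding exponent `S(y) = Σ_j (y_j ∕ P₀) • Y_j` of a commuting family -/

section Unwind

variable (Y : Fin d → Matrix n n ℂ) (P₀ : ℕ)

omit [Fintype n] [DecidableEq n] in
/-- `S(y + e_μ) = S(y) + P₀⁻¹ • Y_μ`. [folklore] -/
theorem unwind_add_e (y : Site d) (μ : Fin d) :
    (∑ j : Fin d, ((((y + e μ) j : ℤ) : ℂ) / (P₀ : ℂ)) • Y j)
      = (∑ j : Fin d, (((y j : ℤ) : ℂ) / (P₀ : ℂ)) • Y j) + ((P₀ : ℂ))⁻¹ • Y μ := by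
  have h : ∀ j : Fin d, ((((y + e μ) j : ℤ) : ℂ) / (P₀ : ℂ)) • Y j
      = (((y j : ℤ) : ℂ) / (P₀ : ℂ)) • Y j + (if j = μ then ((P₀ : ℂ))⁻¹ • Y μ else 0) := by
    intro j
    simp only [Pi.add_apply, e_apply]
    split_ifs with hj
    · subst hj; push_cast; rw [add_div, add_smul, one_div]
    · simp
  rw [Finset.sum_congr rfl fun j _ => h j, Finset.sum_add_distrib, Finset.sum_ite_eq' Finset.univ μ]
  simp

omit [Fintype n] [DecidableEq n] in
/-- `S(y + P₀ e_i) = S(y) + Y_i` (`P₀ ≠ 0`). [folklore] -/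
theorem unwind_add_period [NeZero P₀] (y : Site d) (i : Fin d) :
    (∑ j : Fin d, ((((y + (P₀ : ℤ) • e i) j : ℤ) : ℂ) / (P₀ : ℂ)) • Y j)
      = (∑ j : Fin d, (((y j : ℤ) : ℂ) / (P₀ : ℂ)) • Y j) + Y i := by
  have hP : (P₀ : ℂ) ≠ 0 := by exact_mod_cast NeZero.ne P₀
  have h : ∀ j : Fin d, ((((y + (P₀ : ℤ) • e i) j : ℤ) : ℂ) / (P₀ : ℂ)) • Y j
      = (((y j : ℤ) : ℂ) / (P₀ : ℂ)) • Y j + (if j = i then Y i else 0) := by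
    intro j
    simp only [Pi.add_apply, Pi.smul_apply, smul_eq_mul, e_apply]
    split_ifs with hj
    · subst hj; push_cast; rw [mul_one, add_div, div_self hP, add_smul, one_smul]
    · simp
  rw [Finset.sum_congr rfl fun j _ => h j, Finset.sum_add_distrib, Finset.sum_ite_eq' Finset.univ i]
  simp

variable {Y}

/-- Everything in the commuting family commutes with the unwinding exponent. [folklore] -/
theorem commute_unwind (hY : ∀ i j, Commute (Y i) (Y j)) (c : Fin d → ℂ) (a : ℂ) (i : Fin d) :
    Commute (∑ j : Fin d, c j • Y j) (a • Y i) :=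
  Commute.sum_left _ _ _ fun j _ => ((hY j i).smul_left (c j)).smul_right a

omit [Fintype n] [DecidableEq n] in
/-- The unwinding exponent of a skew-Hermitian family is skew-Hermitian (its coefficients are real). [folklore] -/
theorem unwind_mem_skewAdjoint (hYs : ∀ i, Y i ∈ skewAdjoint (Matrix n n ℂ)) (y : Site d) :
    (∑ j : Fin d, (((y j : ℤ) : ℂ) / (P₀ : ℂ)) • Y j) ∈ skewAdjoint (Matrix n n ℂ) := by
  refine AddSubgroup.sum_mem _ fun j _ => ?_
  rw [skewAdjoint.mem_iff, star_smul, skewAdjoint.mem_iff.mp (hYs j), smul_neg]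
  congr 2
  rw [Complex.star_def, map_div₀, map_intCast, map_natCast]

/-- `exp S(y)` is unitary. [folklore] -/
theorem exp_unwind_mem_unitary (hYs : ∀ i, Y i ∈ skewAdjoint (Matrix n n ℂ)) (y : Site d) :
    expUnit (∑ j : Fin d, (((y j : ℤ) : ℂ) / (P₀ : ℂ)) • Y j) ∈ unitaryUnits (Matrix n n ℂ) := by
  letI : NormedAlgebra ℚ (Matrix n n ℂ) := NormedAlgebra.restrictScalars ℚ ℂ (Matrix n n ℂ)
  exact mem_unitaryUnits.2 (exp_mem_unitary_of_mem_skewAdjoint (unwind_mem_skewAdjoint P₀ hYs y))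

end Unwind

/-! ## §3 The normal form: a periodic gauge onto a constant commuting datum -/

/-- **PERIODIC-GAUGE NORMAL FORM OF A FLAT DATUM.**  Let `U` be unitary of the multi-level class (`SmallField U x`, `LevelSmall`), `(L^{k+1}P₀)`-periodic, with
FLAT `(k+1)`-fold average `D = cavgIter L (k+1) U` (`D(∂p) = 1`), and let `Y_i` be pairwise COMMUTING skew-Hermitian logarithms of the period-`P₀` axis holonomies,
`exp Y_i = D([0, P₀e_i])`.  Then there is a unitary `(L^{k+1}P₀)`-PERIODIC gauge `G` with `cavgIter L (k+1) (U^{G}) = ` the CONSTANT commuting configuration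
`(y,i) ↦ e^{Y_i∕P₀}`. [folklore] -/
theorem exists_periodic_gauge_cavgIter_eq_const [Nonempty n] {L : ℕ} (hL : 1 ≤ L) (k : ℕ) {P₀ : ℕ} [NeZero P₀]
    {U : Site d → Fin d → (Matrix n n ℂ)ˣ} (hU : IsUnitaryCfg U) {x : ℝ} (hx : 0 ≤ x) (hs : LevelSmall d L k x) (hUx : SmallField U x)
    (hUP : IsPeriodicCfg U ((L ^ (k + 1) * P₀ : ℕ) : ℤ))
    (hflatD : ∀ (y : Site d) (κ μ : Fin d), κ ≠ μ → hol (cavgIter L (k + 1) U) y (plaqWord κ μ) = 1)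
    {Y : Fin d → Matrix n n ℂ} (hYs : ∀ i, Y i ∈ skewAdjoint (Matrix n n ℂ)) (hYc : ∀ i j, Commute (Y i) (Y j))
    (hYexp : ∀ i, exp (Y i) = ((hol (cavgIter L (k + 1) U) 0 (seg i (P₀ : ℤ)) : (Matrix n n ℂ)ˣ) : Matrix n n ℂ)) :
    ∃ G : Site d → (Matrix n n ℂ)ˣ, IsUnitarySite G ∧ IsPeriodicSite G ((L ^ (k + 1) * P₀ : ℕ) : ℤ) ∧
      cavgIter L (k + 1) (gaugeAct G U) = fun (_ : Site d) (i : Fin d) => expUnit (((P₀ : ℂ))⁻¹ • Y i) := by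
  letI : NormedAlgebra ℚ (Matrix n n ℂ) := NormedAlgebra.restrictScalars ℚ ℂ (Matrix n n ℂ)
  -- the datum, a flat periodic unitary configuration, is a pure gauge `1^{w}` with `w 0 = 1`
  set D := cavgIter L (k + 1) U with hD
  have hDu : IsUnitaryCfg D := (cavgIter_unitary_small hL k hU hx hs hUx).1
  have hDP : IsPeriodicCfg D (P₀ : ℤ) := by
    refine isPeriodicCfg_cavgIter L P₀ (k + 1) ?_
    rw [tower_eq_pow_mul]
    exact hUP
  obtain ⟨w', hw'u, hDw'⟩ := exists_unitary_gauge_eq_gaugeAct_flatCfg hDu hflatD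
  set w : Site d → (Matrix n n ℂ)ˣ := fun y => w' y * (w' 0)⁻¹ with hw
  have hwu : IsUnitarySite w := fun y =>
    (unitaryUnits (Matrix n n ℂ)).mul_mem (hw'u y) ((unitaryUnits (Matrix n n ℂ)).inv_mem (hw'u 0))
  have hDw : D = gaugeAct w flatCfg := by rw [hDw', hw, gaugeAct_mul_const_flatCfg]
  have hw0 : w 0 = 1 := by simp [hw]
  -- its holonomy constants: `w (y + P₀ e_i) = w y * τ_i⁻¹`, `τ_i = D([0,P₀e_i]) = (w (P₀ e_i))⁻¹`
  have hDPw : IsPeriodicCfg (gaugeAct w (flatCfg : Site d → Fin d → (Matrix n n ℂ)ˣ)) (P₀ : ℤ) := by rw [← hDw]; exact hDP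
  have hτ : ∀ i : Fin d, hol D 0 (seg i (P₀ : ℤ)) = (w ((P₀ : ℤ) • e i))⁻¹ := by
    intro i
    rw [hDw, hol_gaugeAct, disp_seg, zero_add, hw0, one_mul]
    have h1 : hol (flatCfg : Site d → Fin d → (Matrix n n ℂ)ˣ) 0 (seg i (P₀ : ℤ)) = 1 := hol_flat _ _
    rw [h1, one_mul]
  have hwq : ∀ (y : Site d) (i : Fin d), w (y + (P₀ : ℤ) • e i) = w y * (hol D 0 (seg i (P₀ : ℤ)))⁻¹ := by
    intro y i
    rw [apply_add_period_eq_of_isPeriodicCfg hDPw y i, hw0, inv_one, one_mul, hτ, inv_inv]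
  -- the unwinding `E(y) = exp S(y)` and the rewound gauge `V = w·E`
  set S : Site d → Matrix n n ℂ := fun y => ∑ j : Fin d, (((y j : ℤ) : ℂ) / (P₀ : ℂ)) • Y j with hS
  set V : Site d → (Matrix n n ℂ)ˣ := fun y => w y * expUnit (S y) with hV
  have hVu : IsUnitarySite V := fun y =>
    (unitaryUnits (Matrix n n ℂ)).mul_mem (hwu y) (exp_unwind_mem_unitary P₀ hYs y)
  -- `V` is `P₀`-periodic: the holonomy constant `τ_i⁻¹` cancels against `e^{Y_i}`
  have hexpY : ∀ i : Fin d, expUnit (Y i) = hol D 0 (seg i (P₀ : ℤ)) := fun i => Units.ext (by rw [val_expUnit, hYexp i])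
  have hVP : ∀ (y : Site d) (i : Fin d), V (y + (P₀ : ℤ) • e i) = V y := by
    intro y i
    have hSy : S (y + (P₀ : ℤ) • e i) = S y + Y i := unwind_add_period Y P₀ y i
    have hcomm : Commute (S y) (Y i) := by
      have h := commute_unwind (Y := Y) hYc (fun j => (((y j : ℤ) : ℂ) / (P₀ : ℂ))) 1 i
      rwa [one_smul] at h
    have hE : expUnit (S (y + (P₀ : ℤ) • e i)) = expUnit (Y i) * expUnit (S y) := by
      refine Units.ext ?_
      rw [Units.val_mul, val_expUnit, val_expUnit, val_expUnit, hSy, add_comm, exp_add_of_commute hcomm.symm]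
    simp only [hV]
    rw [hwq y i, hE, ← hexpY i]
    group
  -- the gauged datum is the constant `e^{Y_i∕P₀}`
  have hconst : gaugeAct (fun y => (V y)⁻¹) D = fun (_ : Site d) (i : Fin d) => expUnit (((P₀ : ℂ))⁻¹ • Y i) := by
    funext y i
    have hSy : S (y + e i) = S y + ((P₀ : ℂ))⁻¹ • Y i := unwind_add_e Y P₀ y i
    have hcomm : Commute (S y) (((P₀ : ℂ))⁻¹ • Y i) :=
      commute_unwind (Y := Y) hYc (fun j => (((y j : ℤ) : ℂ) / (P₀ : ℂ))) _ i
    have hE : expUnit (S (y + e i)) = expUnit (S y) * expUnit (((P₀ : ℂ))⁻¹ • Y i) := by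
      refine Units.ext ?_
      rw [Units.val_mul, val_expUnit, val_expUnit, val_expUnit, hSy, exp_add_of_commute hcomm]
    rw [hDw]
    simp only [gaugeAct, flatCfg, hV, mul_one, mul_inv_rev, inv_inv, hE]
    group
  -- blow `V⁻¹` up to the fine lattice and use the gauge covariance of the average
  set G : Site d → (Matrix n n ℂ)ˣ := fun z => (V (fun j => z j / (L : ℤ) ^ (k + 1)))⁻¹ with hG
  have hGu : IsUnitarySite G := blowInv_unitary k hVu
  have hGP : IsPeriodicSite G ((L ^ (k + 1) * P₀ : ℕ) : ℤ) := blowInv_add_period hL k hVP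
  refine ⟨G, hGu, hGP, ?_⟩
  rw [cavgIter_gaugeAct hL k hU hx hs hUx hGu]
  have hcorner : (fun y : Site d => G (((L : ℤ) ^ (k + 1)) • y)) = fun y => (V y)⁻¹ := by
    funext y
    exact blowInv_corner hL k V y
  rw [hcorner, ← hD, hconst]

end

end Summit.QuantumFields.BalabanUV.T4Continuum.NE7FlatDatumNormalForm
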